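import Summits.Ventures.Crystal3D.Theorems.StickyWulffConstantGenericWallFloorOfCore
import Summits.Ventures.Crystal3D.Theorems.StickyWulffConstantGenericWallFloorSigma9Holds
import HarnessLib

/-!
# The ray-aligned core of `GenericWallFloor` MINUS the one-sided `Σ9` classes: the crux by name from
# `ExactOnly`(C12-55), `StarPairFar` and the SHRUNK residual (crux `GenericWallFloor`, stmt-Ventures-19480, line `WallLedgerG`)

HONEST FRAMING. Venture `Summits/Ventures/Crystal3D` (cell `crystal3d-full`), helper `--supports` the crux
`GenericWallFloor` of `route-Ventures-StickyWulffConstant`, REGISTERED line `WallLedgerG`, open stub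
`stub_twoSlabAdhesion`.  BOOKKEEPING CAPSTONE, rung credit only; F-C1 not moved; NOT the crux.

19480-p1 g6's `genericWallFloor_of_core` gives the route decl from `ExactOnly`(C12-55), `StarPairFar` and the residual
`GenericWallFloorCore` (the crux's matrix on every ray-aligned non-co-axial pair).  This seat proved the matrix at the
crux's own constant on the two ONE-SIDED `Σ9` CLASSES (`genericWallFloorAtCharge_one_sigma9{,Down}`, `…Sigma9Holds`,
modulo the same two inputs), so the residual shrinks:

* `Sigma9OneSidedAt A₁ A₂` / `Sigma9OneSidedDownAt A₁ A₂` — the hypothesis lists of those two theorems, packaged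
  (a reduced two-letter word presentation, a steep slot of one grain IN its composition plane, a steep slot of the other
  grain, and the level-two condition on the other grain's forced ray in its two readings);
* `GenericWallFloorCoreResidual` — the crux's matrix on ray-aligned non-co-axial pairs OUTSIDE both classes;
* **`genericWallFloor_of_coreResidual`** — `ExactOnly`(C12-55) → `StarPairFar` → `GenericWallFloorCoreResidual` →
  `Summit.Ventures.Crystal3D.Theses.StickyWulffConstant.GenericWallFloor`; and the converse inclusion
  `genericWallFloorCoreResidual_of_core` (the new residual is implied by the old one, so nothing is smuggled).
Numerically (seat folder `calc/full_sigma9.py`) the two classes cover `≈ 83 %` of Haar `Σ9` orientations (the old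
separated class: `38 %`); the residual of the `Σ9` core is `≈ 17 %` (mutual arrival; both grains one-sided only through the
lamella capper).
WHAT THIS IS NOT: a proof of the residual; F-C1 not moved.
-/

noncomputable section

namespace Summit.Ventures.Crystal3D.Theorems

open Summit.Ventures.Crystal3D Finset
open Literature.MathematicalPhysics.StatisticalMechanics (fccStacking barlowStacking IsHaggSeq)
open scoped InnerProductSpace

/-- **The one-sided `Σ9` class, lower grain in-plane**: the hypothesis list of `genericWallFloorAtCharge_one_sigma9`
for the pair `(A₁, A₂)` — a reduced model menu word `[μk, μk1]` with `A₂·Λ₀ = (wordFrame A₁ [μk, μk1])·Λ₀`, a steep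
up-slot `u₁` of grain 1 with `⟪u₁, μk1⟫ = 0`, a steep down-slot `u₂` of grain 2, and the level-two condition on grain 2's
downward forced ray (`hsecond` and `hcap` readings). -/
def Sigma9OneSidedAt (A₁ A₂ : EuclideanSpace ℝ (Fin 3) ≃ₗᵢ[ℝ] EuclideanSpace ℝ (Fin 3)) : Prop :=
  ∃ (u₁ u₂ μk μk1 : EuclideanSpace ℝ (Fin 3)), u₁ ∈ fccSlots ∧
    Real.sqrt 2 / 2 ≤ ⟪A₁ u₁, EuclideanSpace.single (2 : Fin 3) (1 : ℝ)⟫_ℝ ∧ u₂ ∈ fccSlots ∧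
    ⟪A₂ u₂, EuclideanSpace.single (2 : Fin 3) (1 : ℝ)⟫_ℝ ≤ -(Real.sqrt 2 / 2) ∧
    (∀ μ ∈ [μk, μk1], ‖μ‖ = 1 ∧
      ∀ w ∈ fccSlots, ⟪w, μ⟫_ℝ = 0 ∨ ⟪w, μ⟫_ℝ = Real.sqrt (2 / 3) ∨ ⟪w, μ⟫_ℝ = -Real.sqrt (2 / 3)) ∧
    List.IsChain (fun μ μ' => ⟪μ, μ'⟫_ℝ = 1 / 3 ∨ ⟪μ, μ'⟫_ℝ = -1 / 3) [μk, μk1] ∧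
    A₂ '' fccStacking 1 (Real.sqrt (2 / 3)) = (wordFrame A₁ [μk, μk1]) '' fccStacking 1 (Real.sqrt (2 / 3)) ∧
    ⟪u₁, μk1⟫_ℝ = 0 ∧
    (∀ n₁ : EuclideanSpace ℝ (Fin 3),
      (n₁ = wordFrame A₁ [μk, μk1] μk ∨ n₁ = -wordFrame A₁ [μk, μk1] μk) → ⟪A₂ u₂, n₁⟫_ℝ = Real.sqrt (2 / 3) →
      ∀ q ∈ fccSlots, 0 < ⟪twinFrame A₂ n₁ q, n₁⟫_ℝ →
        (∀ q' ∈ fccSlots, 0 < ⟪twinFrame A₂ n₁ q', n₁⟫_ℝ →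
          ⟪twinFrame A₂ n₁ q', -EuclideanSpace.single (2 : Fin 3) (1 : ℝ)⟫_ℝ ≤
            ⟪twinFrame A₂ n₁ q, -EuclideanSpace.single (2 : Fin 3) (1 : ℝ)⟫_ℝ) →
        (wordFrame A₁ [μk, μk1]).symm (A₂ ((twinFrame A₂ n₁).symm ((2 * Real.sqrt (2 / 3)) • twinFrame A₂ n₁ q - n₁))) ≠ μk1 ∧
        (wordFrame A₁ [μk, μk1]).symm (A₂ ((twinFrame A₂ n₁).symm ((2 * Real.sqrt (2 / 3)) • twinFrame A₂ n₁ q - n₁))) ≠ -μk1) ∧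
    (∀ n₁ : EuclideanSpace ℝ (Fin 3),
      (n₁ = wordFrame A₁ [μk, μk1] μk ∨ n₁ = -wordFrame A₁ [μk, μk1] μk) → ⟪A₂ u₂, n₁⟫_ℝ = Real.sqrt (2 / 3) →
      ∀ q ∈ fccSlots, 0 < ⟪twinFrame A₂ n₁ q, n₁⟫_ℝ →
        (∀ q' ∈ fccSlots, 0 < ⟪twinFrame A₂ n₁ q', n₁⟫_ℝ →
          ⟪twinFrame A₂ n₁ q', -EuclideanSpace.single (2 : Fin 3) (1 : ℝ)⟫_ℝ ≤
            ⟪twinFrame A₂ n₁ q, -EuclideanSpace.single (2 : Fin 3) (1 : ℝ)⟫_ℝ) →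
        ⟪twinFrame A₂ n₁ q, A₁ μk1⟫_ℝ = 0)

/-- **The one-sided `Σ9` class, upper grain in-plane** (mirror image): the hypothesis list of
`genericWallFloorAtCharge_one_sigma9Down`. -/
def Sigma9OneSidedDownAt (A₁ A₂ : EuclideanSpace ℝ (Fin 3) ≃ₗᵢ[ℝ] EuclideanSpace ℝ (Fin 3)) : Prop :=
  ∃ (u₁ u₂ μk μk1 : EuclideanSpace ℝ (Fin 3)), u₁ ∈ fccSlots ∧
    Real.sqrt 2 / 2 ≤ ⟪A₁ u₁, EuclideanSpace.single (2 : Fin 3) (1 : ℝ)⟫_ℝ ∧ u₂ ∈ fccSlots ∧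
    ⟪A₂ u₂, EuclideanSpace.single (2 : Fin 3) (1 : ℝ)⟫_ℝ ≤ -(Real.sqrt 2 / 2) ∧
    (∀ μ ∈ [μk, μk1], ‖μ‖ = 1 ∧
      ∀ w ∈ fccSlots, ⟪w, μ⟫_ℝ = 0 ∨ ⟪w, μ⟫_ℝ = Real.sqrt (2 / 3) ∨ ⟪w, μ⟫_ℝ = -Real.sqrt (2 / 3)) ∧
    List.IsChain (fun μ μ' => ⟪μ, μ'⟫_ℝ = 1 / 3 ∨ ⟪μ, μ'⟫_ℝ = -1 / 3) [μk, μk1] ∧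
    A₁ '' fccStacking 1 (Real.sqrt (2 / 3)) = (wordFrame A₂ [μk, μk1]) '' fccStacking 1 (Real.sqrt (2 / 3)) ∧
    ⟪u₂, μk1⟫_ℝ = 0 ∧
    (∀ n₁ : EuclideanSpace ℝ (Fin 3),
      (n₁ = wordFrame A₂ [μk, μk1] μk ∨ n₁ = -wordFrame A₂ [μk, μk1] μk) → ⟪A₁ u₁, n₁⟫_ℝ = Real.sqrt (2 / 3) →
      ∀ q ∈ fccSlots, 0 < ⟪twinFrame A₁ n₁ q, n₁⟫_ℝ →
        (∀ q' ∈ fccSlots, 0 < ⟪twinFrame A₁ n₁ q', n₁⟫_ℝ →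
          ⟪twinFrame A₁ n₁ q', EuclideanSpace.single (2 : Fin 3) (1 : ℝ)⟫_ℝ ≤
            ⟪twinFrame A₁ n₁ q, EuclideanSpace.single (2 : Fin 3) (1 : ℝ)⟫_ℝ) →
        (wordFrame A₂ [μk, μk1]).symm (A₁ ((twinFrame A₁ n₁).symm ((2 * Real.sqrt (2 / 3)) • twinFrame A₁ n₁ q - n₁))) ≠ μk1 ∧
        (wordFrame A₂ [μk, μk1]).symm (A₁ ((twinFrame A₁ n₁).symm ((2 * Real.sqrt (2 / 3)) • twinFrame A₁ n₁ q - n₁))) ≠ -μk1) ∧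
    (∀ n₁ : EuclideanSpace ℝ (Fin 3),
      (n₁ = wordFrame A₂ [μk, μk1] μk ∨ n₁ = -wordFrame A₂ [μk, μk1] μk) → ⟪A₁ u₁, n₁⟫_ℝ = Real.sqrt (2 / 3) →
      ∀ q ∈ fccSlots, 0 < ⟪twinFrame A₁ n₁ q, n₁⟫_ℝ →
        (∀ q' ∈ fccSlots, 0 < ⟪twinFrame A₁ n₁ q', n₁⟫_ℝ →
          ⟪twinFrame A₁ n₁ q', EuclideanSpace.single (2 : Fin 3) (1 : ℝ)⟫_ℝ ≤
            ⟪twinFrame A₁ n₁ q, EuclideanSpace.single (2 : Fin 3) (1 : ℝ)⟫_ℝ) →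
        ⟪twinFrame A₁ n₁ q, A₂ μk1⟫_ℝ = 0)

/-- **The SHRUNK residual of lane G**: the crux's matrix, verbatim, on every non-co-axial RAY-ALIGNED pair that lies in
NEITHER one-sided `Σ9` class. -/
def GenericWallFloorCoreResidual : Prop :=
  ∀ (A₁ : EuclideanSpace ℝ (Fin 3) ≃ₗᵢ[ℝ] EuclideanSpace ℝ (Fin 3)) (t₁ : EuclideanSpace ℝ (Fin 3))
    (A₂ : EuclideanSpace ℝ (Fin 3) ≃ₗᵢ[ℝ] EuclideanSpace ℝ (Fin 3)) (t₂ : EuclideanSpace ℝ (Fin 3)),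
    ¬ (∃ (L : EuclideanSpace ℝ (Fin 3) ≃ₗᵢ[ℝ] EuclideanSpace ℝ (Fin 3)) (s₁ s₂ : EuclideanSpace ℝ (Fin 3))
        (σ σ' : ℤ → ℤ), IsHaggSeq σ ∧ IsHaggSeq σ' ∧
        (fun p => A₁ p + t₁) '' fccStacking 1 (Real.sqrt (2 / 3)) ⊆
          (fun p => L p + s₁) '' barlowStacking 1 (Real.sqrt (2 / 3)) σ ∧
        (fun p => A₂ p + t₂) '' fccStacking 1 (Real.sqrt (2 / 3)) ⊆
          (fun p => L p + s₂) '' barlowStacking 1 (Real.sqrt (2 / 3)) σ') →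
    RayAlignedAt A₁ A₂ → ¬ Sigma9OneSidedAt A₁ A₂ → ¬ Sigma9OneSidedDownAt A₁ A₂ → GenericWallFloorAt A₁ t₁ A₂ t₂

/-- `GenericWallFloorAtCharge 1` is `GenericWallFloorAt` (definitional). -/
theorem genericWallFloorAt_of_charge_one {A₁ : EuclideanSpace ℝ (Fin 3) ≃ₗᵢ[ℝ] EuclideanSpace ℝ (Fin 3)}
    {t₁ : EuclideanSpace ℝ (Fin 3)} {A₂ : EuclideanSpace ℝ (Fin 3) ≃ₗᵢ[ℝ] EuclideanSpace ℝ (Fin 3)} {t₂ : EuclideanSpace ℝ (Fin 3)}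
    (h : GenericWallFloorAtCharge 1 A₁ t₁ A₂ t₂) : GenericWallFloorAt A₁ t₁ A₂ t₂ := h

/-- Pairs in the lower one-sided `Σ9` class satisfy the crux's matrix (modulo `ExactOnly`(C12-55), `StarPairFar`). -/
theorem genericWallFloorAt_of_sigma9OneSidedAt
    {s₀ : EuclideanSpace ℝ (Fin 3)} (hs₀ : s₀ ∈ fccSlots)
    (hcert : ExactOnly 0 (fccSlots.filter fun w => 0 < ⟪w, s₀⟫_ℝ)) (hfar : StarPairFar)
    {A₁ A₂ : EuclideanSpace ℝ (Fin 3) ≃ₗᵢ[ℝ] EuclideanSpace ℝ (Fin 3)} (h : Sigma9OneSidedAt A₁ A₂)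
    (t₁ t₂ : EuclideanSpace ℝ (Fin 3)) : GenericWallFloorAt A₁ t₁ A₂ t₂ := by
  obtain ⟨u₁, u₂, μk, μk1, hu₁, hsteep₁, hu₂, hsteep₂, hκl, hκc, hA₂, hfirst, hsecond, hcap⟩ := h
  exact genericWallFloorAt_of_charge_one (genericWallFloorAtCharge_one_sigma9 hs₀ hcert hfar A₁ t₁ A₂ t₂ hu₁ hsteep₁
    hu₂ hsteep₂ μk μk1 hκl hκc hA₂ hfirst hsecond hcap)

/-- Pairs in the upper one-sided `Σ9` class satisfy the crux's matrix (modulo `ExactOnly`(C12-55), `StarPairFar`). -/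
theorem genericWallFloorAt_of_sigma9OneSidedDownAt
    {s₀ : EuclideanSpace ℝ (Fin 3)} (hs₀ : s₀ ∈ fccSlots)
    (hcert : ExactOnly 0 (fccSlots.filter fun w => 0 < ⟪w, s₀⟫_ℝ)) (hfar : StarPairFar)
    {A₁ A₂ : EuclideanSpace ℝ (Fin 3) ≃ₗᵢ[ℝ] EuclideanSpace ℝ (Fin 3)} (h : Sigma9OneSidedDownAt A₁ A₂)
    (t₁ t₂ : EuclideanSpace ℝ (Fin 3)) : GenericWallFloorAt A₁ t₁ A₂ t₂ := by
  obtain ⟨u₁, u₂, μk, μk1, hu₁, hsteep₁, hu₂, hsteep₂, hκl, hκc, hA₁, hfirst, hsecond, hcap⟩ := h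
  exact genericWallFloorAt_of_charge_one (genericWallFloorAtCharge_one_sigma9Down hs₀ hcert hfar A₁ t₁ A₂ t₂ hu₁ hsteep₁
    hu₂ hsteep₂ μk μk1 hκl hκc hA₁ hfirst hsecond hcap)

/-- **The crux BY NAME from `ExactOnly`(C12-55), `StarPairFar` and the SHRUNK residual.** -/
theorem genericWallFloor_of_coreResidual
    {s₀ : EuclideanSpace ℝ (Fin 3)} (hs₀ : s₀ ∈ fccSlots)
    (hcert : ExactOnly 0 (fccSlots.filter fun w => 0 < ⟪w, s₀⟫_ℝ)) (hfar : StarPairFar)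
    (hres : GenericWallFloorCoreResidual) :
    Summit.Ventures.Crystal3D.Theses.StickyWulffConstant.GenericWallFloor := by
  refine genericWallFloor_of_core hs₀ hcert hfar fun A₁ t₁ A₂ t₂ hnc hra => ?_
  by_cases h₁ : Sigma9OneSidedAt A₁ A₂
  · exact genericWallFloorAt_of_sigma9OneSidedAt hs₀ hcert hfar h₁ t₁ t₂
  by_cases h₂ : Sigma9OneSidedDownAt A₁ A₂
  · exact genericWallFloorAt_of_sigma9OneSidedDownAt hs₀ hcert hfar h₂ t₁ t₂
  exact hres A₁ t₁ A₂ t₂ hnc hra h₁ h₂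

/-- The shrunk residual is implied by the old one (and hence by the crux): nothing is smuggled. -/
theorem genericWallFloorCoreResidual_of_core (h : GenericWallFloorCore) : GenericWallFloorCoreResidual :=
  fun A₁ t₁ A₂ t₂ hnc hra _ _ => h A₁ t₁ A₂ t₂ hnc hra

/-- The crux implies the shrunk residual. -/
theorem genericWallFloorCoreResidual_of_genericWallFloor
    (h : Summit.Ventures.Crystal3D.Theses.StickyWulffConstant.GenericWallFloor) : GenericWallFloorCoreResidual :=
  genericWallFloorCoreResidual_of_core (genericWallFloorCore_of_genericWallFloor h)

end Summit.Ventures.Crystal3D.Theorems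

end
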